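import Summits.MatrixMultiplication.OmegaCensus.SmallFormats.MatMul22nRankGF5XCapDictA1
import Summits.MatrixMultiplication.OmegaCensus.SmallFormats.MatMul22nRankGF5XCapDictA2
import Summits.MatrixMultiplication.OmegaCensus.SmallFormats.MatMul22nRankGF5XCapDictA3
import Summits.MatrixMultiplication.OmegaCensus.SmallFormats.MatMul22nRankGF5XCapDictJ
import Summits.MatrixMultiplication.OmegaCensus.SmallFormats.MatMul22nRankGF5XCapDictQ
import Summits.MatrixMultiplication.OmegaCensus.SmallFormats.MatMul22nRankGF5ThreeNPlusTwo
import HarnessLib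

/-!
# ω-census family (a): core of the kernel replay — a passing `BoxCert` certificate for `xcapSys5` bounds WLOG-normalised computations

Cell `pub-omega` (unit `pub-omega-tensor-g7`), topic `Summits/MatrixMultiplication/OmegaCensus` (sub-folder
`SmallFormats`). Framing (verbatim): lottery ticket; floor = certified bounds/negative ranges. HONEST FRAMING: glue, conditional
on a certificate `c` with `c.check xcapSys5 D 53 2 [] = true` (to be supplied by generated data files) and on the two WLOG
inequalities (to be supplied by two sandwich normalisations); it turns the cap lemmas of the tree into `BoxCert.System.Feasible`
for the class-count vector of the X-forms and reads off `r ≤ 52` at `r ≤ 3n + 2`. Nothing here is progress on `ω`.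
-/

namespace Summit.MatrixMultiplication.OmegaCensus.SmallFormats

open Module Matrix Finset Literature.Computability.AlgebraicComplexity
open Summit.MatrixMultiplication.OmegaCensus.RankOnePlaneCapGeneral

/-! ## Assembly of the chunked dictionary lemmas -/
/-- The column table is the transpose of the row table. -/
theorem xcapSys5_A_eq (r : Fin 498) (j : Fin 157) : xcapSys5.A r.val j.val = rowCoef5 r.val j.val := by
  have h := r.isLt
  by_cases h0 : r.val < 50
  · exact xcapSys5_A_eq_0 r ⟨by omega, h0⟩ j
  by_cases h1 : r.val < 100
  · exact xcapSys5_A_eq_1 r ⟨by omega, h1⟩ j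
  by_cases h2 : r.val < 150
  · exact xcapSys5_A_eq_2 r ⟨by omega, h2⟩ j
  by_cases h3 : r.val < 200
  · exact xcapSys5_A_eq_3 r ⟨by omega, h3⟩ j
  by_cases h4 : r.val < 250
  · exact xcapSys5_A_eq_4 r ⟨by omega, h4⟩ j
  by_cases h5 : r.val < 300
  · exact xcapSys5_A_eq_5 r ⟨by omega, h5⟩ j
  by_cases h6 : r.val < 350
  · exact xcapSys5_A_eq_6 r ⟨by omega, h6⟩ j
  by_cases h7 : r.val < 400
  · exact xcapSys5_A_eq_7 r ⟨by omega, h7⟩ j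
  by_cases h8 : r.val < 450
  · exact xcapSys5_A_eq_8 r ⟨by omega, h8⟩ j
  exact xcapSys5_A_eq_9 r ⟨by omega, h⟩ j
/-- Cap and row-plane rows are `0/1` rows given by `rowMem5`. -/
theorem rowCoef5_eq_mem (r : Fin 350) (j : Fin 157) : rowCoef5 r.val j.val = if rowMem5 r.val j.val then 1 else 0 := by
  have h := r.isLt
  by_cases h0 : r.val < 50
  · exact rowCoef5_eq_mem_0 r ⟨by omega, h0⟩ j
  by_cases h1 : r.val < 100
  · exact rowCoef5_eq_mem_1 r ⟨by omega, h1⟩ j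
  by_cases h2 : r.val < 150
  · exact rowCoef5_eq_mem_2 r ⟨by omega, h2⟩ j
  by_cases h3 : r.val < 200
  · exact rowCoef5_eq_mem_3 r ⟨by omega, h3⟩ j
  by_cases h4 : r.val < 250
  · exact rowCoef5_eq_mem_4 r ⟨by omega, h4⟩ j
  by_cases h5 : r.val < 300
  · exact rowCoef5_eq_mem_5 r ⟨by omega, h5⟩ j
  exact rowCoef5_eq_mem_6 r ⟨by omega, h⟩ j

/-- Assembly step for certificate skeletons: a branch node passes if its side conditions hold and both children pass
(children paths stated with `hiOf/loOf` unevaluated; chunk lemmas with literal paths match by `rfl`). -/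
theorem BoxCert.check_branch (S : BoxCert.System) {D T s j v : ℕ} {up dn : BoxCert.Cert} {path : List (ℕ × ℕ × ℕ)}
    (h1 : BoxCert.loOf path j ≤ v) (h2 : v < BoxCert.hiOf s path j)
    (hu : up.check S D T s ((j, v + 1, BoxCert.hiOf s path j) :: path) = true)
    (hd : dn.check S D T s ((j, BoxCert.loOf path j, v) :: path) = true) :
    (BoxCert.Cert.branch j v up dn).check S D T s path = true := by
  simp [BoxCert.Cert.check, h1, h2, hu, hd]

variable {ι : Type*} [Fintype ι]

/-- Number of X-forms in class `j` (`j = 156`: zero forms). -/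
def xcount5 (u : ι → Fin 2 × Fin 2 → ZMod 5) (j : ℕ) : ℕ := (univ.filter fun t => xvar5 (u t) = j).card

/-- The class counts add up to the number of forms. -/
theorem sum_xcount5 (u : ι → Fin 2 × Fin 2 → ZMod 5) : ∑ j ∈ range 157, xcount5 u j = Fintype.card ι := by
  classical
  unfold xcount5
  rw [← Finset.card_univ, Finset.card_eq_sum_card_fiberwise (f := fun t => xvar5 (u t)) (s := Finset.univ) (t := range 157)
    (fun t _ => mem_range.2 (xvar5_lt (u t)))]

/-- Counting through a `0/1` row: `∑_j [rowMem ρ j]·x_j = #{t : rowMem ρ (xvar (u t))}`. -/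
theorem sum_rowMem5_xcount5 (u : ι → Fin 2 × Fin 2 → ZMod 5) (ρ : ℕ) :
    ∑ j ∈ range 157, (if rowMem5 ρ j then (1 : ℤ) else 0) * (xcount5 u j : ℤ)
      = ((univ.filter fun t => rowMem5 ρ (xvar5 (u t)) = true).card : ℤ) := by
  classical
  unfold xcount5
  rw [Finset.card_eq_sum_card_fiberwise (f := fun t => xvar5 (u t)) (s := univ.filter fun t => rowMem5 ρ (xvar5 (u t)) = true)
    (t := range 157) (fun t _ => mem_range.2 (xvar5_lt (u t)))]
  push_cast
  refine sum_congr rfl fun j _ => ?_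
  by_cases h : rowMem5 ρ j = true
  · rw [if_pos h, one_mul]
    congr 2
    ext t
    simp only [mem_filter, mem_univ, true_and]
    constructor
    · intro ht; exact ⟨by rw [ht]; exact h, ht⟩
    · intro ht; exact ht.2
  · rw [if_neg h, zero_mul]
    symm
    rw [Nat.cast_eq_zero, Finset.card_eq_zero, Finset.filter_eq_empty_iff]
    intro t ht
    rw [mem_filter] at ht
    intro hj
    rw [hj] at ht
    exact h ht.2

/-- `xcapSys5_A_eq` with plain indices. -/
theorem xcapSys5_A_eq' {ρ j : ℕ} (hρ : ρ < 498) (hj : j < 157) : xcapSys5.A ρ j = rowCoef5 ρ j :=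
  xcapSys5_A_eq ⟨ρ, hρ⟩ ⟨j, hj⟩
/-- `rowCoef5_eq_mem` with plain indices. -/
theorem rowCoef5_eq_mem' {ρ j : ℕ} (hρ : ρ < 350) (hj : j < 157) :
    rowCoef5 ρ j = if rowMem5 ρ j then 1 else 0 := rowCoef5_eq_mem ⟨ρ, hρ⟩ ⟨j, hj⟩
/-- `rowCoef5_sym` with plain indices. -/
theorem rowCoef5_sym' {ρ j : ℕ} (hρ : ρ < 498) (h350 : 350 ≤ ρ) (hj : j < 157) :
    rowCoef5 ρ j = (if j = symVar5 ρ then 1 else 0) - (if j = symPivot5 ρ then 1 else 0) :=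
  rowCoef5_sym ⟨ρ, hρ⟩ h350 ⟨j, hj⟩
/-- `symVar5_lt` with plain indices. -/
theorem symVar5_lt' {ρ : ℕ} (hρ : ρ < 498) (h350 : 350 ≤ ρ) : symVar5 ρ < 156 ∧ symVar5 ρ ≠ symPivot5 ρ :=
  symVar5_lt ⟨ρ, hρ⟩ h350
/-- `first5_ok` with plain indices. -/
theorem first5_ok' {j : ℕ} (hj : j < 156) : fld 9 FIRST5 j < 344 ∧ rowMem5 (fld 9 FIRST5 j) j = true := first5_ok ⟨j, hj⟩
/-- `rowMem5_z` with plain indices. -/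
theorem rowMem5_z' {ρ : ℕ} (hρ : ρ < 350) : rowMem5 ρ 156 = true := rowMem5_z ⟨ρ, hρ⟩

variable [DecidableEq ι]

/-- Cap rows: at most `|ι| − 3n` forms are members of a capped row `ρ < 344`. -/
theorem card_rowMem5_cap_le {n : ℕ} (β : BilinComp (mulBilin (ZMod 5) 2 2 n) ι) (u : ι → Fin 2 × Fin 2 → ZMod 5)
    (hA : ∀ i x, β.f i x = dotX (u i) x) {ρ : ℕ} (hρ : ρ < 344) :
    3 * n + (univ.filter fun t => rowMem5 ρ (xvar5 (u t)) = true).card ≤ Fintype.card ι := by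
  classical
  by_cases hJ : ρ < 144
  · have h := (jPlane5 ⟨ρ, hJ⟩).three_mul_add_card_le β u hA (fun t => perpJ5 (u t) ⟨ρ, hJ⟩ = true)
      (fun t ht => perpJ5_dotX ht)
    have e : (univ.filter fun t => rowMem5 ρ (xvar5 (u t)) = true) = (univ.filter fun t => perpJ5 (u t) ⟨ρ, hJ⟩ = true) := by
      ext t; simp only [mem_filter, mem_univ, true_and, perpJ5_eq_rowMem]
    rw [e]; exact h
  · have hl : ρ - 144 < 200 := by omega
    have h := (qPlane5 ⟨ρ - 144, hl⟩).three_mul_add_card_le zmod5_sq_ne β u hA (fun t => perpQ5 (u t) ⟨ρ - 144, hl⟩ = true)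
      (fun t ht => perpQ5_dotX ht)
    have e : (univ.filter fun t => rowMem5 ρ (xvar5 (u t)) = true) = (univ.filter fun t => perpQ5 (u t) ⟨ρ - 144, hl⟩ = true) := by
      ext t
      simp only [mem_filter, mem_univ, true_and, perpQ5_eq_rowMem]
      have : 144 + (ρ - 144) = ρ := by omega
      rw [this]
    rw [e]; exact h

omit [DecidableEq ι] in
/-- Row-plane rows: at most `2|ι| − 6n` forms are members of row `344 + i`. -/
theorem card_rowMem5_row_le {n : ℕ} (β : BilinComp (mulBilin (ZMod 5) 2 2 n) ι) (u : ι → Fin 2 × Fin 2 → ZMod 5)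
    (hA : ∀ i x, β.f i x = dotX (u i) x) (i : Fin 6) :
    (univ.filter fun t => rowMem5 (344 + i.val) (xvar5 (u t)) = true).card + 6 * n ≤ 2 * Fintype.card ι := by
  classical
  have h := card_vanishing_le_two_mul_sub (n := n) (le_refl 2) β (p1rep_ne_zero (lamIdx5 i))
    (univ.filter fun t => p1rep (lamIdx5 i) ᵥ* xMat (u t) = 0)
    (fun t ht z => by
      rw [mem_filter] at ht
      rw [hA, dotX_vecMulVec_eq, ht.2, zero_dotProduct])
  have e : (univ.filter fun t => rowMem5 (344 + i.val) (xvar5 (u t)) = true)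
      = (univ.filter fun t => p1rep (lamIdx5 i) ᵥ* xMat (u t) = 0) := by
    ext t; simp only [mem_filter, mem_univ, true_and, rowVanish_iff_rowMem]
  rw [e]; exact h

/-- **Core of the kernel replay.** If some certificate passes for `xcapSys5` (denominator `D`, target `53`, box `[0,2]`), then
every computation of `⟨2,2,n⟩` over `𝔽₅` with `|ι| ≤ 3n + 2` products whose X-form class counts satisfy the WLOG rows has
`|ι| ≤ 52`. -/
theorem card_le_52_of_cert {D : ℕ} (c : BoxCert.Cert) (hc : c.check xcapSys5 D 53 2 [] = true)
    {n : ℕ} (hι : Fintype.card ι ≤ 3 * n + 2)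
    (β : BilinComp (mulBilin (ZMod 5) 2 2 n) ι) (u : ι → Fin 2 × Fin 2 → ZMod 5) (hA : ∀ i x, β.f i x = dotX (u i) x)
    (hW : ∀ ρ, 350 ≤ ρ → ρ < 498 → xcount5 u (symVar5 ρ) ≤ xcount5 u (symPivot5 ρ)) :
    Fintype.card ι ≤ 52 := by
  classical
  set x : ℕ → ℕ := fun j => xcount5 u j with hx
  -- box
  have hcap : ∀ ρ < 344, (univ.filter fun t => rowMem5 ρ (xvar5 (u t)) = true).card ≤ 2 := by
    intro ρ hρ; have := card_rowMem5_cap_le β u hA hρ; omega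
  have hbox : ∀ j, x j ≤ 2 := by
    intro j
    by_cases hj : j < 157
    · -- a capped row containing `j`
      obtain ⟨ρ, hρ, hmem⟩ : ∃ ρ < 344, rowMem5 ρ j = true := by
        by_cases hj' : j < 156
        · exact ⟨_, (first5_ok' hj').1, (first5_ok' hj').2⟩
        · have : j = 156 := by omega
          subst this
          exact ⟨0, by norm_num, rowMem5_z' (by norm_num)⟩
      refine le_trans ?_ (hcap ρ hρ)
      refine Finset.card_le_card fun t ht => ?_
      simp only [mem_filter, mem_univ, true_and] at ht ⊢
      rw [ht]; exact hmem
    · have : x j = 0 := by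
        simp only [hx, xcount5, Finset.card_eq_zero, Finset.filter_eq_empty_iff]
        intro t _ ht
        have := xvar5_lt (u t); omega
      omega
  -- feasibility
  have hfeas : xcapSys5.Feasible x := by
    intro ρ hρ
    change ρ < 498 at hρ
    show ∑ j ∈ range 157, xcapSys5.A ρ j * (x j : ℤ) ≤ rhs5 ρ
    have eA : ∀ j ∈ range 157, xcapSys5.A ρ j * (x j : ℤ) = rowCoef5 ρ j * (x j : ℤ) := by
      intro j hj
      rw [xcapSys5_A_eq' hρ (mem_range.1 hj)]
    rw [sum_congr rfl eA]
    by_cases h350 : ρ < 350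
    · have eM : ∀ j ∈ range 157, rowCoef5 ρ j * (x j : ℤ) = (if rowMem5 ρ j then (1 : ℤ) else 0) * (xcount5 u j : ℤ) := by
        intro j hj
        rw [rowCoef5_eq_mem' h350 (mem_range.1 hj)]
      rw [sum_congr rfl eM, sum_rowMem5_xcount5]
      by_cases h344 : ρ < 344
      · have h1 := hcap ρ h344
        have : rhs5 ρ = 2 := by simp [rhs5, h344]
        rw [this]; exact_mod_cast h1
      · obtain ⟨i, hi⟩ : ∃ i : Fin 6, ρ = 344 + i.val := ⟨⟨ρ - 344, by omega⟩, by simp; omega⟩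
        have h1 := card_rowMem5_row_le β u hA i
        have : rhs5 ρ = 4 := by simp [rhs5, h344, h350]
        rw [this, hi]
        have h2 : (univ.filter fun t => rowMem5 (344 + i.val) (xvar5 (u t)) = true).card ≤ 4 := by omega
        exact_mod_cast h2
    · have h350' : 350 ≤ ρ := not_lt.1 h350
      have eS : ∀ j ∈ range 157, rowCoef5 ρ j * (x j : ℤ)
          = (if j = symVar5 ρ then (x j : ℤ) else 0) - (if j = symPivot5 ρ then (x j : ℤ) else 0) := by
        intro j hj
        rw [rowCoef5_sym' hρ h350' (mem_range.1 hj)]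
        split_ifs <;> simp
      rw [sum_congr rfl eS, sum_sub_distrib, sum_ite_eq' (range 157), sum_ite_eq' (range 157)]
      have hs := symVar5_lt' hρ h350'
      have hsv : symVar5 ρ ∈ range 157 := mem_range.2 (by omega)
      have hpv : symPivot5 ρ ∈ range 157 := mem_range.2 (by unfold symPivot5; split_ifs <;> norm_num)
      rw [if_pos hsv, if_pos hpv]
      have : rhs5 ρ = 0 := by simp [rhs5]; omega
      rw [this]
      have hw' : (xcount5 u (symVar5 ρ) : ℤ) ≤ (xcount5 u (symPivot5 ρ) : ℤ) := by exact_mod_cast hW ρ h350' hρ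
      simp only [hx]
      linarith
  -- the certificate
  have hlt := BoxCert.Cert.sum_lt_of_check_root xcapSys5 xcapSys5_colWF c hc x hbox hfeas
  change ∑ j ∈ range 157, xcount5 u j < 53 at hlt
  rw [sum_xcount5] at hlt
  omega

end Summit.MatrixMultiplication.OmegaCensus.SmallFormats
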